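import Summits.KontsevichZagierPeriods.KontsevichZagierPeriods.Theses.WickWedge
import Literature.NumberTheory.Transcendental.KZKernelConjectureForms

/-!
# `SumRuleSixKillSwitch` (stmt-KontsevichZagierPeriods-5658, route WickWedge) — proof

Kill switch of route WickWedge: given two six-dimensional integral representations `r₃`, `r₁`
(the Wick-rotated Bessel moments `R(3,3;1)` and `R(1,5;1)` of the `k = 6` sum rule, described by
their domains and integrands) with the value identity `r₃.value = 3 * r₁.value` as a hypothesis,
a proof that `[r₃] - 3 • [r₁]` is NOT a KZ relation refutes the summit. Pure logic: the summit is
the two-representation form of Conjecture 1 (`KontsevichZagierPeriods_iff`), equivalent to the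
kernel form `∀ c, KZ.eval c = 0 → c ∈ KZ.relations`
(`Literature.NumberTheory.Transcendental.kzKernelConjecture_iff_isRational`, proved in tree); the
combination `c := [r₃] - 3 • [r₁]` has `eval c = r₃.value - 3 * r₁.value = 0`, contradiction.
The shape hypotheses (domains, integrands) are not used.
Landed by lead c10 of crux stmt-KontsevichZagierPeriods-9129 (banking). No definitions.
-/

namespace Summit.KontsevichZagierPeriods.WickWedge

open Literature.NumberTheory.Transcendental

/-- **`SumRuleSixKillSwitch`** (route WickWedge, stmt-KontsevichZagierPeriods-5658): if
`r₃.value = 3 * r₁.value` and `KZ.of r₃ - 3 • KZ.of r₁ ∉ KZ.relations`, then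
`¬ KontsevichZagierPeriods`. Proof: the summit gives the kernel form of Conjecture 1
(`kzKernelConjecture_iff_isRational.mpr ∘ KontsevichZagierPeriods_iff.mp`), which applies to
`c := KZ.of r₃ - 3 • KZ.of r₁` since `KZ.eval c = r₃.value - 3 * r₁.value = 0` (`KZ.eval_of`,
additivity of `KZ.eval`). [folklore] -/
theorem sumRuleSixKillSwitch_proof :
    Summit.KontsevichZagierPeriods.KontsevichZagierPeriods.Theses.WickWedge.SumRuleSixKillSwitch := by
  intro r₃ r₁ _ _ _ _ hv hnot h
  have hK : KZKernelConjecture :=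
    kzKernelConjecture_iff_isRational.mpr (KontsevichZagierPeriods_iff.mp h)
  refine hnot (hK _ ?_)
  rw [map_sub, map_nsmul, KZ.eval_of, KZ.eval_of, hv, nsmul_eq_mul, Nat.cast_ofNat, sub_self]

end Summit.KontsevichZagierPeriods.WickWedge
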